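import Summits.CriticalPhenomena.PercolationContinuityZ3.Theorems.PercNearOneGluingNoHeavyLowerTailSunflowerMinorCube
import HarnessLib
import HarnessLib.Audit

/-!
# `NoHeavyLowerTail` (crux stmt-CriticalPhenomena-4575), abstract sunflower cubic: towards `MinorSuperadditivity` (DC) at a PETAL point —
# part 1: the cube inequality with the cross pairs avoiding the petal, and minors with a non-bottom contracted set

Support file (seat `prim-l12-p2` gen 20; `--supports stmt-CriticalPhenomena-4575`).  No `sorry`.  One auxiliary `ℤ`-valued definition
(`Sunflower.cubeH`, the summand of a finite check).  Memo: run/shared/lean/prim/prim-l12/prim-l12-p2/FINDING-g20-COMPLEMENT-READING.md §10.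

Setting of `…SunflowerMinorInduction` / `…SunflowerMinorCube`: minor `(W;C)`, cube counts `minorAB C U`, `minorCR C U`, slack `f = minorSlack`.
Let `x ∉ U` and let the contracted point be a PETAL point: `k := lab (C ∪ {x}) ∉ {0,4}`.  Then every label `lab (T ∪ C ∪ {x})` is `k` or `4`.

* `Sunflower.minorCube_petal` — **PETAL CUBE INEQUALITY**: `gl_F(U ∪ {x}) ≥ gl_d(U) + t_k(U)` where `gl_F`, `gl_d` are the slacks of the
  cube `U ∪ {x}` resp. `U` in `(·;C)` and `t_k(U)` is the number of cross pairs of `U` (in `(·;C)`) BOTH of whose labels differ from `k`.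
  Proof as in `minorCube_superadditive`: indicator expansion over `T ⊆ U` and a finite symmetrised pointwise check (`cubeH_symm_nonneg`,
  `decide`); combinatorially: the kernel–bottom pairs of `U ∪ {x}` that are not kernel–bottom pairs of `U` contain all `(0 | j)`-pairs of `U`
  (`j ≠ k` petal: adding `x` on the petal side makes it kernel), which pay for the cross pairs of `U ∪ {x}` whose `x`-side is bottom without `x`.
* `Sunflower.minorSlack_eq_zero_of_lab_ne_zero` — a minor whose contracted set is not bottom has neither bottom spectators nor rainbows:
  `f(W;C) = 0` if `lab C ≠ 0` (so the contraction summand of (DC) vanishes at every non-bottom point).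
* `Sunflower.minorBottoms_eq_of_lab_insert_ne_zero` — at a non-bottom point `x` the bottom spectators of `(W;C)` are those of `(W∖x;C)`.
Part 2 (`…SunflowerMinorPetal`) adds the rainbow injection and concludes (DC) at every petal point.
-/

namespace Summit.CriticalPhenomena.PercolationContinuityZ3.Theorems.SunflowerPartition

open Finset

namespace Sunflower

variable {α : Type*} [Fintype α] [DecidableEq α] (F : Sunflower α)

/-! ## The finite check -/

/-- Summand of `gl_F(U∪{x}) − gl_d(U) − t_k(U)` at `T ⊆ U`, in the labels `a = d T`, `b = c T`, `a' = d (U∖T)`, `b' = c (U∖T)`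
(`d = lab(·∪C)`, `c = lab(·∪C∪{x})`). [this work] -/
def cubeH (k a b a' b' : Fin 5) : ℤ :=
  (if a = 0 ∧ b' = 4 then 1 else 0) + (if b = 0 ∧ a' = 4 then 1 else 0)
  - (if b' ≠ 0 ∧ b' ≠ 4 ∧ a ≠ 0 ∧ a ≠ 4 ∧ b' < a then 1 else 0) - (if a' ≠ 0 ∧ a' ≠ 4 ∧ b ≠ 0 ∧ b ≠ 4 ∧ a' < b then 1 else 0)
  - (if a = 0 ∧ a' = 4 then 1 else 0)
  + (if a' ≠ 0 ∧ a' ≠ 4 ∧ a ≠ 0 ∧ a ≠ 4 ∧ a' < a then 1 else 0)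
  - (if a' ≠ 0 ∧ a' ≠ 4 ∧ a' ≠ k ∧ a ≠ 0 ∧ a ≠ 4 ∧ a ≠ k ∧ a' < a then 1 else 0)

/-- **The pointwise bound** (finite check): `cubeH(T) + cubeH(U∖T) ≥ 0` whenever `d ≤ c` in `M₃` on both sides and the `c`-labels lie in
`{k,4}`, `k` a petal. [this work] -/
theorem cubeH_symm_nonneg : ∀ k a b a' b' : Fin 5, k ≠ 0 → k ≠ 4 →
    (a = b ∨ a = 0 ∨ b = 4) → (a' = b' ∨ a' = 0 ∨ b' = 4) → (b = k ∨ b = 4) → (b' = k ∨ b' = 4) →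
    0 ≤ cubeH k a b a' b' + cubeH k a' b' a b := by
  unfold cubeH; decide

omit [Fintype α] in
/-- With `lab (C ∪ {x}) ≠ 0`, every `lab (T ∪ C ∪ {x})` is `lab (C ∪ {x})` or `4`. [this work] -/
theorem lab_union_insert_cases (T C : Finset α) (x : α) (hk0 : F.lab (insert x C) ≠ 0) :
    F.lab (T ∪ insert x C) = F.lab (insert x C) ∨ F.lab (T ∪ insert x C) = 4 :=
  F.lab_superset subset_union_right hk0

/-! ## The petal cube inequality -/

omit [Fintype α] in
/-- **PETAL CUBE INEQUALITY** (this work): for `x ∉ U` and `k = lab (C ∪ {x})` a petal, the slack of the cube `U ∪ {x}` in `(·;C)` is at least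
the slack of `U` in `(·;C)` plus the number of cross pairs of `U` avoiding the petal `k`. [this work] -/
theorem minorCube_petal (C U : Finset α) (x : α) (hxU : x ∉ U) (hk0 : F.lab (insert x C) ≠ 0) (hk4 : F.lab (insert x C) ≠ 4) :
    ((F.minorAB C U : ℤ) - F.minorCR C U)
      + ((U.powerset.filter (fun Y => F.lab ((U \ Y) ∪ C) ≠ 0 ∧ F.lab ((U \ Y) ∪ C) ≠ 4 ∧ F.lab ((U \ Y) ∪ C) ≠ F.lab (insert x C) ∧
          F.lab (Y ∪ C) ≠ 0 ∧ F.lab (Y ∪ C) ≠ 4 ∧ F.lab (Y ∪ C) ≠ F.lab (insert x C) ∧ F.lab ((U \ Y) ∪ C) < F.lab (Y ∪ C))).card : ℤ)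
      ≤ (F.minorAB C (insert x U) : ℤ) - F.minorCR C (insert x U) := by
  set k := F.lab (insert x C) with hkdef
  set d : Finset α → Fin 5 := fun T => F.lab (T ∪ C) with hd
  set c : Finset α → Fin 5 := fun T => F.lab (T ∪ insert x C) with hc
  have hxT : ∀ T ∈ U.powerset, x ∉ T := fun T hT hx => hxU (mem_powerset.1 hT hx)
  have e1 : ∀ T ∈ U.powerset, insert x U \ T = insert x (U \ T) := by
    intro T hT; rw [Finset.insert_sdiff_of_notMem _ (hxT T hT)]
  have e2 : ∀ T ∈ U.powerset, insert x U \ insert x T = U \ T := by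
    intro T hT
    rw [Finset.insert_sdiff_insert, Finset.sdiff_insert_of_notMem hxU]
  have e3 : ∀ T : Finset α, insert x T ∪ C = T ∪ insert x C := by
    intro T; ext y; simp only [mem_union, mem_insert]; tauto
  -- expansions (as in `minorCube_superadditive`)
  have hABF : (F.minorAB C (insert x U) : ℤ)
      = ∑ T ∈ U.powerset, ((if d T = 0 ∧ c (U \ T) = 4 then (1 : ℤ) else 0) + (if c T = 0 ∧ d (U \ T) = 4 then (1 : ℤ) else 0)) := by
    rw [F.minorAB_eq_sum, Finset.sum_powerset_insert hxU, ← Finset.sum_add_distrib]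
    refine sum_congr rfl fun T hT => ?_
    rw [e1 T hT, e2 T hT, e3, e3]
  have hCRF : (F.minorCR C (insert x U) : ℤ)
      = ∑ T ∈ U.powerset, ((if c (U \ T) ≠ 0 ∧ c (U \ T) ≠ 4 ∧ d T ≠ 0 ∧ d T ≠ 4 ∧ c (U \ T) < d T then (1 : ℤ) else 0)
          + (if d (U \ T) ≠ 0 ∧ d (U \ T) ≠ 4 ∧ c T ≠ 0 ∧ c T ≠ 4 ∧ d (U \ T) < c T then (1 : ℤ) else 0)) := by
    rw [F.minorCR_eq_sum, Finset.sum_powerset_insert hxU, ← Finset.sum_add_distrib]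
    refine sum_congr rfl fun T hT => ?_
    rw [e1 T hT, e2 T hT, e3, e3]
    simp only [hd, hc]
    congr 1
    · by_cases h : F.lab (T ∪ C) ≠ 0 ∧ F.lab (T ∪ C) ≠ 4 ∧ F.lab (U \ T ∪ insert x C) ≠ 0 ∧ F.lab (U \ T ∪ insert x C) ≠ 4 ∧
          F.lab (U \ T ∪ insert x C) < F.lab (T ∪ C)
      · rw [if_pos h, if_pos ⟨h.2.2.1, h.2.2.2.1, h.1, h.2.1, h.2.2.2.2⟩]
      · rw [if_neg h, if_neg fun h' => h ⟨h'.2.2.1, h'.2.2.2.1, h'.1, h'.2.1, h'.2.2.2.2⟩]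
    · by_cases h : F.lab (T ∪ insert x C) ≠ 0 ∧ F.lab (T ∪ insert x C) ≠ 4 ∧ F.lab (U \ T ∪ C) ≠ 0 ∧ F.lab (U \ T ∪ C) ≠ 4 ∧
          F.lab (U \ T ∪ C) < F.lab (T ∪ insert x C)
      · rw [if_pos h, if_pos ⟨h.2.2.1, h.2.2.2.1, h.1, h.2.1, h.2.2.2.2⟩]
      · rw [if_neg h, if_neg fun h' => h ⟨h'.2.2.1, h'.2.2.2.1, h'.1, h'.2.1, h'.2.2.2.2⟩]
  have hABd : (F.minorAB C U : ℤ) = ∑ T ∈ U.powerset, (if d T = 0 ∧ d (U \ T) = 4 then (1 : ℤ) else 0) := F.minorAB_eq_sum C U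
  have hCRd : (F.minorCR C U : ℤ)
      = ∑ T ∈ U.powerset, (if d (U \ T) ≠ 0 ∧ d (U \ T) ≠ 4 ∧ d T ≠ 0 ∧ d T ≠ 4 ∧ d (U \ T) < d T then (1 : ℤ) else 0) := by
    rw [F.minorCR_eq_sum]
    refine sum_congr rfl fun T _ => ?_
    simp only [hd]
    by_cases h : F.lab (T ∪ C) ≠ 0 ∧ F.lab (T ∪ C) ≠ 4 ∧ F.lab (U \ T ∪ C) ≠ 0 ∧ F.lab (U \ T ∪ C) ≠ 4 ∧ F.lab (U \ T ∪ C) < F.lab (T ∪ C)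
    · rw [if_pos h, if_pos ⟨h.2.2.1, h.2.2.2.1, h.1, h.2.1, h.2.2.2.2⟩]
    · rw [if_neg h, if_neg fun h' => h ⟨h'.2.2.1, h'.2.2.2.1, h'.1, h'.2.1, h'.2.2.2.2⟩]
  have htK : ((U.powerset.filter (fun Y => F.lab ((U \ Y) ∪ C) ≠ 0 ∧ F.lab ((U \ Y) ∪ C) ≠ 4 ∧ F.lab ((U \ Y) ∪ C) ≠ F.lab (insert x C) ∧
          F.lab (Y ∪ C) ≠ 0 ∧ F.lab (Y ∪ C) ≠ 4 ∧ F.lab (Y ∪ C) ≠ F.lab (insert x C) ∧ F.lab ((U \ Y) ∪ C) < F.lab (Y ∪ C))).card : ℤ)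
      = ∑ T ∈ U.powerset, (if d (U \ T) ≠ 0 ∧ d (U \ T) ≠ 4 ∧ d (U \ T) ≠ k ∧ d T ≠ 0 ∧ d T ≠ 4 ∧ d T ≠ k ∧ d (U \ T) < d T
          then (1 : ℤ) else 0) := by
    rw [Finset.sum_boole]
  -- the difference is `Σ_T cubeH`
  have hsum : (F.minorAB C (insert x U) : ℤ) - F.minorCR C (insert x U)
      - (((F.minorAB C U : ℤ) - F.minorCR C U)
        + ((U.powerset.filter (fun Y => F.lab ((U \ Y) ∪ C) ≠ 0 ∧ F.lab ((U \ Y) ∪ C) ≠ 4 ∧ F.lab ((U \ Y) ∪ C) ≠ F.lab (insert x C) ∧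
            F.lab (Y ∪ C) ≠ 0 ∧ F.lab (Y ∪ C) ≠ 4 ∧ F.lab (Y ∪ C) ≠ F.lab (insert x C) ∧ F.lab ((U \ Y) ∪ C) < F.lab (Y ∪ C))).card : ℤ))
      = ∑ T ∈ U.powerset, cubeH k (d T) (c T) (d (U \ T)) (c (U \ T)) := by
    rw [hABF, hCRF, hABd, hCRd, htK]
    unfold cubeH
    simp only [← Finset.sum_sub_distrib, ← Finset.sum_add_distrib]
    refine sum_congr rfl fun T _ => ?_
    ring
  have hsymm : (∑ T ∈ U.powerset, cubeH k (d T) (c T) (d (U \ T)) (c (U \ T)))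
      = ∑ T ∈ U.powerset, cubeH k (d (U \ T)) (c (U \ T)) (d T) (c T) := by
    rw [← HallGladkov.sum_powerset_compl U (fun T => cubeH k (d T) (c T) (d (U \ T)) (c (U \ T)))]
    refine sum_congr rfl fun T hT => ?_
    rw [Finset.sdiff_sdiff_eq_self (mem_powerset.1 hT)]
  have h2 : 0 ≤ 2 * (∑ T ∈ U.powerset, cubeH k (d T) (c T) (d (U \ T)) (c (U \ T))) := by
    rw [two_mul]
    nth_rewrite 2 [hsymm]
    rw [← Finset.sum_add_distrib]
    refine Finset.sum_nonneg fun T _ => ?_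
    exact cubeH_symm_nonneg k _ _ _ _ hk0 hk4 (F.lab_union_le T C x) (F.lab_union_le (U \ T) C x)
      (F.lab_union_insert_cases T C x hk0) (F.lab_union_insert_cases (U \ T) C x hk0)
  have key : 0 ≤ (F.minorAB C (insert x U) : ℤ) - F.minorCR C (insert x U)
      - (((F.minorAB C U : ℤ) - F.minorCR C U)
        + ((U.powerset.filter (fun Y => F.lab ((U \ Y) ∪ C) ≠ 0 ∧ F.lab ((U \ Y) ∪ C) ≠ 4 ∧ F.lab ((U \ Y) ∪ C) ≠ F.lab (insert x C) ∧
            F.lab (Y ∪ C) ≠ 0 ∧ F.lab (Y ∪ C) ≠ 4 ∧ F.lab (Y ∪ C) ≠ F.lab (insert x C) ∧ F.lab ((U \ Y) ∪ C) < F.lab (Y ∪ C))).card : ℤ)) := by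
    rw [hsum]; linarith
  linarith

/-! ## Minors with a non-bottom contracted set -/

omit [Fintype α] in
/-- A minor whose contracted set is not bottom has no bottom spectators and no rainbows: `f(W;C) = 0` if `lab C ≠ 0`. [this work] -/
theorem minorSlack_eq_zero_of_lab_ne_zero (W C : Finset α) (hC : F.lab C ≠ 0) : F.minorSlack W C = 0 := by
  have hall : ∀ T : Finset α, F.lab (T ∪ C) = F.lab C ∨ F.lab (T ∪ C) = 4 := fun T => F.lab_superset subset_union_right hC
  have hne0 : ∀ T : Finset α, F.lab (T ∪ C) ≠ 0 := by
    intro T h; rcases hall T with h' | h'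
    · exact hC (h'.symm.trans h)
    · rw [h'] at h; exact absurd h (by decide)
  unfold minorSlack
  have hR : F.minorRainbows W C = 0 := by
    unfold minorRainbows
    rw [Finset.card_eq_zero, Finset.filter_eq_empty_iff]
    intro q _ h
    obtain ⟨h1, h2, -⟩ := h
    rcases hall q.1 with e1 | e1
    · rcases hall q.2 with e2 | e2
      · rw [h1] at e1; rw [h2] at e2; rw [← e1] at e2; exact absurd e2 (by decide)
      · rw [h2] at e2; exact absurd e2 (by decide)
    · rw [h1] at e1; exact absurd e1 (by decide)
  rw [hR, Finset.filter_false_of_mem (fun S _ => hne0 S)]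
  simp

omit [Fintype α] in
/-- At a non-bottom point `x` (`lab (C ∪ {x}) ≠ 0`), the bottom spectators of `(W;C)` all avoid `x`. [this work] -/
theorem minorBottoms_eq_of_lab_insert_ne_zero (W C : Finset α) (x : α) (hk0 : F.lab (insert x C) ≠ 0) :
    W.powerset.filter (fun S => F.lab (S ∪ C) = 0) = (W.erase x).powerset.filter (fun S => F.lab (S ∪ C) = 0) := by
  ext S
  simp only [mem_filter, mem_powerset]
  constructor
  · rintro ⟨hSW, hS0⟩
    refine ⟨fun y hy => ?_, hS0⟩
    rw [mem_erase]
    refine ⟨fun hyx => ?_, hSW hy⟩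
    subst hyx
    have hsub : insert y C ⊆ S ∪ C := by
      intro z hz; rcases mem_insert.1 hz with rfl | h
      · exact mem_union_left _ hy
      · exact mem_union_right _ h
    rcases F.lab_superset hsub hk0 with h | h
    · exact hk0 (h.symm.trans hS0)
    · rw [hS0] at h; exact absurd h (by decide)
  · rintro ⟨hSW', hS0⟩
    exact ⟨hSW'.trans (Finset.erase_subset x W), hS0⟩

end Sunflower

end Summit.CriticalPhenomena.PercolationContinuityZ3.Theorems.SunflowerPartition
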